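import Summits.QuantumAdvantage.QuantumAdvantage.Theorems.NearExactIsExact.Negative.SmallCasesAnf

/-!
# Small cases of `NearExactIsExact` (stmt-QuantumAdvantage-14043), part 3/4: substitutions and classes

Linear substitutions by row lists (`lapp`, degree preservation `isDegLeFun_lapp`), `Φ` under an invertible linear
substitution (`forrelation_lin`), generator data (`GenRows`, `GenRows.Good`) and the transport
`OK78 (g ∘ B) → OK78 g` (`ok78_of_comp`); classes of cubic functions by cubic part (`InClass`, `Qc`), members of a
class are `gfun`s (`exists_gfun_of_inClass`), the linear part is a character (`signOf_linear`), substitution tables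
(`TabOK`, `cactL`, `remL`) and the transport of classes along a generator (`inClass_comp`, `qc_transport`).
References: Carlet 2021 §2.2.1; Aaronson–Ambainis 2018 §1.1.1.
-/

set_option linter.dupNamespace false -- D-0017: single-problem summit ⇒ `QuantumAdvantage.QuantumAdvantage` by design

namespace Summit.QuantumAdvantage.QuantumAdvantage.Theorems.NearExactIsExact.Negative.SmallCases

open Finset
open Literature.Computability.QuantumComplexity
open Literature.Computability.QuantumComplexity.DerivativeWalsh (W fsum phi_eq_fsum fsum_eq_sum_mul_W)
open Literature.Computability.QuantumComplexity.BuzetChailloux (phi_signOf bxor bxor_comm bxor_bxor_cancel_left)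
open Literature.Computability.QuantumComplexity.Simon (twist_xor_left)
open Summit.QuantumAdvantage.QuantumAdvantage.Theorems.SignedExactSliceIsLift
  (subsets3 indic mcoeff cubicMonomials litVal monoVal evalMonos truncOf)
open Summit.QuantumAdvantage.QuantumAdvantage.Theorems.SignedExactSliceIsLift.StubMoebius
  (isDegLeFun_xor isDegLeFun_and isDegLeFun_all isDegLeFun_litVal bz_foldl_xor sum_map_filter_eq toInput_indic eval_bz
    card_support_le sum_subInd truncOf_eq)
open Summit.QuantumAdvantage.QuantumAdvantage.Theorems.CubicForrelation.NearExactIsExact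
  (bb_exists_dual bb_band_of_dual_degree bb_rmWeight_holds stub_houCubic stub_axParity nf_isDegLeFun_subst)

variable {n : ℕ}

/-! ### Linear substitutions given by row lists -/

/-- Value of the linear form `⊕_{j ∈ row} x_j` (indices `≥ n` read `false`). [folklore] -/
def rowVal (n : ℕ) (row : List ℕ) (x : Fin n → Bool) : Bool := row.foldr (fun j acc => xor (litVal n x j) acc) false

/-- The linear map given by a list of rows. [folklore] -/
def lapp (n : ℕ) (rows : List (List ℕ)) (x : Fin n → Bool) : Fin n → Bool := fun i => rowVal n (rows.getD i.val []) x

/-- A linear substitution does not raise the degree. [cite: Carlet2020, §2.2.1 Def. 6] -/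
theorem isDegLeFun_lapp {d : ℕ} {F : (Fin n → Bool) → Bool} (hF : IsDegLeFun d F) (rows : List (List ℕ)) :
    IsDegLeFun d (fun x => F (lapp n rows x)) := by
  classical
  -- the polynomial of a row
  let Xl : ℕ → MvPolynomial (Fin n) (ZMod 2) := fun j => if h : j < n then MvPolynomial.X ⟨j, h⟩ else 0
  let rowP : List ℕ → MvPolynomial (Fin n) (ZMod 2) := fun row => row.foldr (fun j acc => Xl j + acc) 0
  have hdeg : ∀ row : List ℕ, (rowP row).totalDegree ≤ 1 := by
    intro row
    induction row with
    | nil => simp [rowP]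
    | cons j row ih =>
      show (Xl j + List.foldr (fun j acc => Xl j + acc) 0 row).totalDegree ≤ 1
      refine (MvPolynomial.totalDegree_add _ _).trans (max_le ?_ ih)
      simp only [Xl]
      split_ifs with h
      · exact (MvPolynomial.totalDegree_X (R := ZMod 2) _).le
      · simp
  have hval : ∀ (row : List ℕ) (x : Fin n → Bool), (if rowVal n row x then (1 : ZMod 2) else 0) =
      MvPolynomial.eval (fun j => if x j then (1 : ZMod 2) else 0) (rowP row) := by
    intro row x
    induction row with
    | nil => simp [rowVal, rowP]
    | cons j row ih =>
      show (if xor (litVal n x j) (List.foldr (fun j acc => xor (litVal n x j) acc) false row) then (1 : ZMod 2) else 0)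
        = MvPolynomial.eval _ (Xl j + List.foldr (fun j acc => Xl j + acc) 0 row)
      have hx : ∀ a b : Bool, (if xor a b then (1 : ZMod 2) else 0) = (if a then (1 : ZMod 2) else 0) + (if b then 1 else 0) := by
        decide
      rw [hx, map_add, ← ih]
      congr 1
      by_cases h : j < n
      · simp only [Xl, litVal, dif_pos h, MvPolynomial.eval_X]
      · simp only [Xl, litVal, dif_neg h, map_zero]
        simp
  exact nf_isDegLeFun_subst (fun i => rowP (rows.getD i.val [])) (fun i => hdeg _) (lapp n rows)
    (fun x i => hval _ x) hF

/-- The dot-product parity `⊕_{i<n} x_i y_i`. [folklore] -/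
def bdot (n : ℕ) (x y : Fin n → Bool) : Bool := (List.range n).foldr (fun i acc => xor (litVal n x i && litVal n y i) acc) false

/-- Accumulator shift for an xor-fold. [folklore] -/
theorem foldr_xor_acc {α : Type*} (p : α → Bool) (l : List α) (b : Bool) :
    l.foldr (fun a acc => xor (p a) acc) b = xor (l.foldr (fun a acc => xor (p a) acc) false) b := by
  induction l with
  | nil => simp
  | cons a l ih => simp only [List.foldr_cons]; rw [ih]; cases p a <;> cases b <;> simp

/-- A `±1`-product over `range n` is the sign of the corresponding xor-fold. [folklore] -/
theorem prod_range_sign (p : ℕ → Bool) : ∀ n : ℕ,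
    ∏ i ∈ range n, (if p i then (-1 : ℝ) else 1) = signOf ((List.range n).foldr (fun i acc => xor (p i) acc) false)
  | 0 => by simp [signOf]
  | n + 1 => by
    have e : (List.range n ++ [n]).foldr (fun i acc => xor (p i) acc) false =
        xor ((List.range n).foldr (fun i acc => xor (p i) acc) false) (p n) := by
      rw [List.foldr_append, List.foldr_cons, List.foldr_nil, foldr_xor_acc, Bool.xor_false]
    rw [prod_range_succ, prod_range_sign p n, List.range_succ, e, signOf_xor]
    rfl

/-- The twist is the sign of the dot-product parity. [folklore] -/
theorem twist_eq_signOf_bdot (x y : Fin n → Bool) : twist x y = signOf (bdot n x y) := by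
  unfold twist bdot
  rw [← prod_range_sign (fun i => litVal n x i && litVal n y i) n,
    ← Fin.prod_univ_eq_prod_range (fun i => if (litVal n x i && litVal n y i) then (-1 : ℝ) else 1) n]
  refine prod_congr rfl fun i _ => ?_
  simp [litVal, i.isLt]

/-- **Linear substitution in `Φ`.** If `Minv` is inverse to `M`, `Ninv` to `N`, and `N` is adjoint to `Minv`
(`Minv y · x = y · N x`), then `Φ(f, h ∘ M) = Φ(f ∘ Ninv, h)`. [cite: AaronsonAmbainis2018, §1.1.1] -/
theorem forrelation_lin (f h : (Fin n → Bool) → Bool) (M Minv N Ninv : (Fin n → Bool) → (Fin n → Bool))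
    (hM : ∀ y, M (Minv y) = y) (hM' : ∀ y, Minv (M y) = y) (hN : ∀ x, N (Ninv x) = x) (hN' : ∀ x, Ninv (N x) = x)
    (hadj : ∀ x y, bdot n x (Minv y) = bdot n (N x) y) :
    forrelation f (fun y => h (M y)) = forrelation (fun x => f (Ninv x)) h := by
  unfold forrelation
  congr 1
  let eM : (Fin n → Bool) ≃ (Fin n → Bool) := ⟨Minv, M, hM, hM'⟩
  let eN : (Fin n → Bool) ≃ (Fin n → Bool) := ⟨Ninv, N, hN, hN'⟩
  calc ∑ x, ∑ y, signOf (f x) * twist x y * signOf (h (M y))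
      = ∑ x, ∑ y, signOf (f x) * twist x (Minv y) * signOf (h y) := by
        refine sum_congr rfl fun x _ => ?_
        exact (Equiv.sum_comp eM (fun y => signOf (f x) * twist x y * signOf (h (M y)))).symm.trans
          (sum_congr rfl fun y _ => by simp [eM, hM])
    _ = ∑ x, ∑ y, signOf (f x) * twist (N x) y * signOf (h y) := by
        refine sum_congr rfl fun x _ => sum_congr rfl fun y _ => ?_
        rw [twist_eq_signOf_bdot, twist_eq_signOf_bdot, hadj]
    _ = ∑ x, ∑ y, signOf (f (Ninv x)) * twist x y * signOf (h y) := by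
        exact (Equiv.sum_comp eN (fun x => ∑ y, signOf (f x) * twist (N x) y * signOf (h y))).symm.trans
          (sum_congr rfl fun x _ => by simp [eN, hN])

/-- Data of an invertible linear generator: the map `B`, its inverse, its transpose and inverse transpose, as
row lists. -/
structure GenRows where
  /-- rows of `B` -/
  B : List (List ℕ)
  /-- rows of `B⁻¹` -/
  Binv : List (List ℕ)
  /-- rows of `Bᵀ` -/
  Bt : List (List ℕ)
  /-- rows of `B⁻ᵀ` -/
  Btinv : List (List ℕ)

/-- The identities a generator must satisfy (decidable; checked by `decide` per instance). -/
def GenRows.Good (n : ℕ) (G : GenRows) : Prop :=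
  (∀ x, lapp n G.B (lapp n G.Binv x) = x) ∧ (∀ x, lapp n G.Binv (lapp n G.B x) = x) ∧
  (∀ x, lapp n G.Bt (lapp n G.Btinv x) = x) ∧ (∀ x, lapp n G.Btinv (lapp n G.Bt x) = x) ∧
  (∀ x y, bdot n x (lapp n G.B y) = bdot n (lapp n G.Bt x) y)

/-- `GenRows.Good` is decidable. -/
instance (n : ℕ) (G : GenRows) : Decidable (G.Good n) := by unfold GenRows.Good; infer_instance

/-- **Transport of `OK78` back along a generator**: `OK78 (g ∘ B) → OK78 g`. [folklore] -/
theorem ok78_of_comp {G : GenRows} (hG : G.Good n) {g : (Fin n → Bool) → Bool}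
    (h : OK78 (fun x => g (lapp n G.B x))) : OK78 g := by
  obtain ⟨h1, h2, h3, h4, h5⟩ := hG
  intro f hf hlt
  -- g = (g ∘ B) ∘ B⁻¹ and Φ(f, (g∘B)∘B⁻¹) = Φ(f ∘ B⁻ᵀ, g ∘ B)
  have e : forrelation f g = forrelation (fun x => f (lapp n G.Btinv x)) (fun x => g (lapp n G.B x)) := by
    have := forrelation_lin f (fun x => g (lapp n G.B x)) (lapp n G.Binv) (lapp n G.B) (lapp n G.Bt) (lapp n G.Btinv)
      h2 h1 h3 h4 h5
    simpa [h1] using this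
  rw [e] at hlt ⊢
  exact h _ (isDegLeFun_lapp hf _) hlt




/-! ### Degrees of the mask functions -/

/-- An indexed XOR of monomials with at most `d` literals each has degree `≤ d`. [cite: Carlet2020, §2.2.1] -/
theorem isDegLeFun_ixval {d : ℕ} (L : List (List ℕ)) (hL : ∀ S ∈ L, (S.take 3).length ≤ d) :
    ∀ i M : ℕ, IsDegLeFun d (fun x : Fin n → Bool => ixval n L i M x) := by
  induction L with
  | nil => intro i M; exact isDegLeFun_const d false
  | cons S L ih =>
    intro i M
    have hS : IsDegLeFun d (fun x : Fin n → Bool => (M.testBit i && monoVal n S x)) := by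
      cases M.testBit i
      · exact isDegLeFun_const d false
      · have h := (isDegLeFun_all (n := n) (S.take 3)).mono (hL S List.mem_cons_self)
        simpa [monoVal] using h
    exact isDegLeFun_xor hS (ih (fun T hT => hL T (List.mem_cons_of_mem _ hT)) (i + 1) M)

/-- The linear part has degree `≤ 1`. [cite: Carlet2020, §2.2.1] -/
theorem isDegLeFun_singles (a : ℕ) : IsDegLeFun 1 (fun x : Fin n → Bool => ixval n (singles n) 0 a x) :=
  isDegLeFun_ixval _ (fun S hS => by obtain ⟨i, -, rfl⟩ := mem_singles hS; simp) 0 a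

/-- The quadratic part has degree `≤ 2`. [cite: Carlet2020, §2.2.1] -/
theorem isDegLeFun_pairs (q : ℕ) : IsDegLeFun 2 (fun x : Fin n → Bool => ixval n (pairs n) 0 q x) :=
  isDegLeFun_ixval _ (fun S hS => by obtain ⟨i, j, -, -, rfl⟩ := mem_pairs hS; simp) 0 q

/-- The cubic form of a mask is cubic. [cite: Carlet2020, §2.2.1] -/
theorem isDegLeFun_cubicF (c : ℕ) : IsDegLeFun 3 (fun x : Fin n → Bool => cubicF n c x) :=
  isDegLeFun_ixval _ (fun S hS => by obtain ⟨i, j, l, -, -, -, rfl⟩ := mem_trips hS; simp) 0 c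

/-- `gfun` is cubic. [cite: Carlet2020, §2.2.1] -/
theorem isDegLeFun_gfun (c q a : ℕ) (b : Bool) : IsDegLeFun 3 (gfun n c q a b) := by
  unfold gfun
  exact isDegLeFun_xor (isDegLeFun_xor (isDegLeFun_xor (isDegLeFun_const 3 b) ((isDegLeFun_singles a).mono (by norm_num)))
    ((isDegLeFun_pairs q).mono (by norm_num))) (isDegLeFun_cubicF c)

/-! ### Classes of cubic functions by their cubic part -/

/-- `g` has cubic part `c`: `g ⊕ C_c` has degree `≤ 2`. -/
def InClass (n c : ℕ) (g : (Fin n → Bool) → Bool) : Prop := IsDegLeFun 2 (fun x => xor (g x) (cubicF n c x))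

/-- The class statement: every cubic `g` with cubic part `c` has the isolation property. -/
def Qc (n c : ℕ) : Prop := ∀ g : (Fin n → Bool) → Bool, IsDegLeFun 3 g → InClass n c g → OK78 g

/-- A `gfun` is in the class of its cubic mask. [folklore] -/
theorem inClass_gfun (c q a : ℕ) (b : Bool) : InClass n c (gfun n c q a b) := by
  unfold InClass
  have e : (fun x => xor (gfun n c q a b x) (cubicF n c x)) =
      fun x => xor (xor b (ixval n (singles n) 0 a x)) (ixval n (pairs n) 0 q x) := by
    funext x
    unfold gfun cubicF
    generalize ixval n (singles n) 0 a x = A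
    generalize ixval n (pairs n) 0 q x = B
    generalize ixval n (trips n) 0 c x = C
    cases b <;> cases A <;> cases B <;> cases C <;> rfl
  rw [e]
  exact isDegLeFun_xor (isDegLeFun_xor (isDegLeFun_const 2 b) ((isDegLeFun_singles a).mono (by norm_num)))
    (isDegLeFun_pairs q)

/-- **Members of a class are `gfun`s with that cubic mask** (Möbius bridge + vanishing of cubic coefficients in
degree `≤ 2`). [cite: Carlet2020, §2.2.1] -/
theorem exists_gfun_of_inClass {c : ℕ} {g : (Fin n → Bool) → Bool} (hcl : InClass n c g) :
    ∃ q a b, q < 2 ^ (pairs n).length ∧ g = gfun n c q a b := by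
  set r : (Fin n → Bool) → Bool := fun x => xor (g x) (cubicF n c x) with hr
  have hr2 : IsDegLeFun 2 r := hcl
  have hrep := gfun_of_cubic r (hr2.mono (by norm_num))
  have h0 : maskOf (mco n r) (trips n) = 0 :=
    maskOf_eq_zero _ _ fun S hS => mcoeff_eq_false_of_deg_two r hr2 hS
  refine ⟨maskOf (mco n r) (pairs n), maskOf (mco n r) (singles n), mco n r [], maskOf_lt _ _, funext fun x => ?_⟩
  have hx : r x = gfun n 0 (maskOf (mco n r) (pairs n)) (maskOf (mco n r) (singles n)) (mco n r []) x := by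
    rw [← h0]; exact congrFun hrep x
  have hg : g x = xor (r x) (cubicF n c x) := by
    show g x = xor (xor (g x) (cubicF n c x)) (cubicF n c x)
    cases g x <;> cases cubicF n c x <;> rfl
  rw [hg, hx]
  unfold gfun cubicF
  rw [ixval_zero]
  generalize ixval n (singles n) 0 (maskOf (mco n r) (singles n)) x = A
  generalize ixval n (pairs n) 0 (maskOf (mco n r) (pairs n)) x = B
  generalize ixval n (trips n) 0 c x = C
  cases mco n r [] <;> cases A <;> cases B <;> cases C <;> rfl

/-! ### The linear part is a character -/

/-- Pointwise-congruent xor-folds agree. [folklore] -/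
theorem foldr_xor_congr {α : Type*} {p q : α → Bool} {l : List α} (h : ∀ a ∈ l, p a = q a) (b : Bool) :
    l.foldr (fun a acc => xor (p a) acc) b = l.foldr (fun a acc => xor (q a) acc) b := by
  induction l with
  | nil => rfl
  | cons a l ih =>
    simp only [List.foldr_cons]
    rw [h a List.mem_cons_self, ih fun x hx => h x (List.mem_cons_of_mem _ hx)]

/-- `ixval` over consecutive singletons is an xor-fold. [folklore] -/
theorem ixval_singletons (a : ℕ) (y : Fin n → Bool) : ∀ (k i : ℕ),
    ixval n ((List.range' i k).map fun j => [j]) i a y =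
      (List.range' i k).foldr (fun j acc => xor (a.testBit j && litVal n y j) acc) false
  | 0, i => rfl
  | k + 1, i => by
    rw [List.range'_succ, List.map_cons, List.foldr_cons]
    show xor (a.testBit i && monoVal n [i] y) (ixval n ((List.range' (i + 1) k).map fun j => [j]) (i + 1) a y) = _
    rw [ixval_singletons a y k (i + 1)]
    simp [monoVal]

/-- **The linear part is the character of `pt n a`**: `(−1)^{ℓ_a(y)} = (−1)^{pt(a)·y}`. [folklore] -/
theorem signOf_linear (a : ℕ) (y : Fin n → Bool) : signOf (ixval n (singles n) 0 a y) = twist (pt n a) y := by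
  rw [twist_eq_signOf_bdot]
  congr 1
  unfold bdot singles
  rw [List.range_eq_range', ixval_singletons]
  refine foldr_xor_congr (fun j hj => ?_) false
  rw [List.mem_range'] at hj
  have hjn : j < n := by omega
  simp [litVal, hjn, pt]

/-- **`OK78` passes from `gfun c q 0 false` to `gfun c q a b`** (affine strip). [folklore] -/
theorem ok78_gfun_affine {c q : ℕ} (h : OK78 (gfun n c q 0 false)) (a : ℕ) (b : Bool) : OK78 (gfun n c q a b) := by
  have key := ok78_affine h (pt n a) (fun y => signOf_linear a y) b
  have e : (fun y => xor (xor b (ixval n (singles n) 0 a y)) (gfun n c q 0 false y)) = gfun n c q a b := by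
    funext y
    unfold gfun
    rw [ixval_zero]
    generalize ixval n (singles n) 0 a y = A
    generalize ixval n (pairs n) 0 q y = B
    generalize ixval n (trips n) 0 c y = C
    cases b <;> cases A <;> cases B <;> cases C <;> rfl
  rw [e] at key
  exact key

/-! ### Generator tables and the transport of classes -/

/-- A substitution-table entry: image cubic mask, and the quadratic / linear masks and constant of the remainder. -/
abbrev Entry := ℕ × ℕ × ℕ × Bool

/-- The remainder (degree `≤ 2`) function of an entry. -/
def remOf (n : ℕ) (e : Entry) (x : Fin n → Bool) : Bool :=
  xor (xor e.2.2.2 (ixval n (singles n) 0 e.2.2.1 x)) (ixval n (pairs n) 0 e.2.1 x)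

/-- The remainder has degree `≤ 2`. [cite: Carlet2020, §2.2.1] -/
theorem isDegLeFun_remOf (e : Entry) : IsDegLeFun 2 (fun x : Fin n → Bool => remOf n e x) :=
  isDegLeFun_xor (isDegLeFun_xor (isDegLeFun_const 2 _) ((isDegLeFun_singles _).mono (by norm_num))) (isDegLeFun_pairs _)

/-- Table correctness for the rows `B`: each cubic monomial composed with `B` is the entry's cubic form plus its
remainder (checked by exhaustion per instance). -/
def TabOK (n : ℕ) (B : List (List ℕ)) (tab : List Entry) : Prop :=
  tab.length = (trips n).length ∧
  ∀ t, t < (trips n).length → ∀ x : Fin n → Bool,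
    monoVal n ((trips n).getD t []) (lapp n B x) =
      xor (cubicF n (tab.getD t (0, 0, 0, false)).1 x) (remOf n (tab.getD t (0, 0, 0, false)) x)

/-- `TabOK` is decidable. -/
instance (n : ℕ) (B : List (List ℕ)) (tab : List Entry) : Decidable (TabOK n B tab) := by
  unfold TabOK; infer_instance

/-- The mask action of a table: XOR of the image masks of the selected monomials. -/
def cactL : List Entry → ℕ → ℕ → ℕ
  | [], _, _ => 0
  | e :: es, i, c => (if c.testBit i then e.1 else 0) ^^^ cactL es (i + 1) c

/-- The total remainder of a table on a mask. -/
def remL (n : ℕ) : List Entry → ℕ → ℕ → (Fin n → Bool) → Bool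
  | [], _, _, _ => false
  | e :: es, i, c, x => xor (c.testBit i && remOf n e x) (remL n es (i + 1) c x)

/-- The total remainder has degree `≤ 2`. [cite: Carlet2020, §2.2.1] -/
theorem isDegLeFun_remL (tab : List Entry) : ∀ i c : ℕ, IsDegLeFun 2 (fun x : Fin n → Bool => remL n tab i c x) := by
  induction tab with
  | nil => intro i c; exact isDegLeFun_const 2 false
  | cons e es ih =>
    intro i c
    have h1 : IsDegLeFun 2 (fun x : Fin n → Bool => (c.testBit i && remOf n e x)) := by
      cases c.testBit i
      · exact isDegLeFun_const 2 false
      · simpa using isDegLeFun_remOf (n := n) e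
    exact isDegLeFun_xor h1 (ih (i + 1) c)

/-- **Composition through a table**: `ixval L i c ∘ B = cubicF (cact c) ⊕ remL c` when the table is correct for `L`.
[folklore] -/
theorem ixval_comp (B : List (List ℕ)) : ∀ (L : List (List ℕ)) (tab : List Entry) (i : ℕ),
    tab.length = L.length →
    (∀ j, j < L.length → ∀ x : Fin n → Bool, monoVal n (L.getD j []) (lapp n B x) =
      xor (cubicF n (tab.getD j (0, 0, 0, false)).1 x) (remOf n (tab.getD j (0, 0, 0, false)) x)) →
    ∀ (c : ℕ) (x : Fin n → Bool), ixval n L i c (lapp n B x) = xor (cubicF n (cactL tab i c) x) (remL n tab i c x)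
  | [], [], _, _, _ => fun c x => by simp [ixval, cactL, remL, cubicF_zero]
  | [], _ :: _, _, h, _ => by simp at h
  | _ :: _, [], _, h, _ => by simp at h
  | S :: L, e :: es, i, hlen, hyp => by
    intro c x
    have h0 := hyp 0 (by simp) x
    simp only [List.getD_cons_zero] at h0
    have ih := ixval_comp B L es (i + 1) (by simpa using hlen)
      (fun j hj x => by simpa using hyp (j + 1) (by simpa using hj) x) c x
    show xor (c.testBit i && monoVal n S (lapp n B x)) (ixval n L (i + 1) c (lapp n B x)) =
      xor (cubicF n ((if c.testBit i then e.1 else 0) ^^^ cactL es (i + 1) c) x)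
        (xor (c.testBit i && remOf n e x) (remL n es (i + 1) c x))
    rw [h0, ih, cubicF_xor]
    have e1 : cubicF n (if c.testBit i then e.1 else 0) x = (c.testBit i && cubicF n e.1 x) := by
      cases c.testBit i
      · exact cubicF_zero x
      · simp
    rw [e1]
    generalize cubicF n e.1 x = A
    generalize remOf n e x = R
    generalize cubicF n (cactL es (i + 1) c) x = A'
    generalize remL n es (i + 1) c x = R'
    cases c.testBit i <;> cases A <;> cases R <;> cases A' <;> cases R' <;> rfl

/-- **Classes are transported by the mask action**: `g` of cubic part `c` gives `g ∘ B` of cubic part `c·B`. [folklore] -/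
theorem inClass_comp {B : List (List ℕ)} {tab : List Entry} (hT : TabOK n B tab) {c : ℕ} {g : (Fin n → Bool) → Bool}
    (hg : InClass n c g) : InClass n (cactL tab 0 c) (fun x => g (lapp n B x)) := by
  obtain ⟨hlen, hyp⟩ := hT
  have e : ∀ x, cubicF n c (lapp n B x) = xor (cubicF n (cactL tab 0 c) x) (remL n tab 0 c x) :=
    ixval_comp B (trips n) tab 0 hlen hyp c
  have h1 : IsDegLeFun 2 (fun x => xor (g (lapp n B x)) (cubicF n c (lapp n B x))) := isDegLeFun_lapp hg B
  have h2 := isDegLeFun_remL (n := n) tab 0 c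
  have h3 := isDegLeFun_xor h1 h2
  have e2 : (fun x => xor (g (lapp n B x)) (cubicF n (cactL tab 0 c) x)) =
      fun x => xor (xor (g (lapp n B x)) (cubicF n c (lapp n B x))) (remL n tab 0 c x) := by
    funext x
    rw [e x]
    generalize g (lapp n B x) = G
    generalize cubicF n (cactL tab 0 c) x = A
    generalize remL n tab 0 c x = R
    cases G <;> cases A <;> cases R <;> rfl
  unfold InClass
  rw [e2]
  exact h3

/-- **Transport of the class statement**: `Qc (c·B) → Qc c`. [folklore] -/
theorem qc_transport {G : GenRows} (hG : G.Good n) {tab : List Entry} (hT : TabOK n G.B tab) {c : ℕ}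
    (h : Qc n (cactL tab 0 c)) : Qc n c :=
  fun _ hg hcl => ok78_of_comp hG (h _ (isDegLeFun_lapp hg G.B) (inClass_comp hT hcl))


end Summit.QuantumAdvantage.QuantumAdvantage.Theorems.NearExactIsExact.Negative.SmallCases
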